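import Summits.CriticalPhenomena.PercolationContinuityZ3.Theorems.Transplant.PlanarSkeletonFrmQuasiDefs
import Summits.CriticalPhenomena.PercolationContinuityZ3.Theorems.Transplant.SkelFrmQuasiBChoiceDefs
import Summits.CriticalPhenomena.PercolationContinuityZ3.Theorems.Transplant.SkelFrmBChoiceDefs
import Summits.CriticalPhenomena.PercolationContinuityZ3.Theorems.Transplant.SkelFrmQuasi1ChoiceDefs
import Summits.CriticalPhenomena.PercolationContinuityZ3.Theorems.Transplant.SkelFrmQuasi1ParamsLBL
import Summits.CriticalPhenomena.PercolationContinuityZ3.Theorems.Transplant.SkelFrmQuasi1ParamsLF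
import Summits.CriticalPhenomena.PercolationContinuityZ3.Theorems.Transplant.SkelFrmQuasi1ParamsPO
import Summits.CriticalPhenomena.PercolationContinuityZ3.Theorems.Transplant.SkelFrmQuasi1SlotTypes
import HarnessLib
import Summits.CriticalPhenomena.PercolationContinuityZ3.Theorems.Transplant.SkelFrmBChoiceDefs3
/-!
# GEN-Q PORT (WAVE-Q table v0.8 section 2, row G039, U-level L8; captain R-6/R-7 2026-08-27: carrier token swap `PlanarSkeletonFrmFrom ↦ PlanarSkeletonFrmQuasi`)
# of the tree module «Transplant/SkelFrmFromBChoiceDefs3» (sha256 62f1e7db990add1d…) onto the quasi-step carrier `PlanarSkeletonFrmQuasi` (p507026): «SkelFrmQuasiBChoiceDefs3»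

ORIGINAL TITLE: N2 (the frames-only node `SamePDropOfSkeletonFrm₁`, OPEN): THE CHOICE FUNCTION OF RECORD WITH THE STEP-I‴ ACCURACY AT THE CUBE — `NegB.δI3`, `NegB.choiceAtQ3`,

builds on p205010 (kernel theorem, internal audit signed; external expert review pending) — nothing in this file uses p205010; NOTHING is claimed about any open node
((N3-b), the end state).  Lane `prim-bschramm`, seat `prim-bschramm-stmt` (gen 33; GEN-Q column pen; tool = captain gen-1 g4's port_genq.py R-14 --cone + p3-g30's T1 patch).  Helper file (`--supports stmt-CriticalPhenomena-4575 --as helper`).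
PORT RULES (U-wave r1–r4 re-used, GEN-Q hunk classes of p3-g29 #6136): declaration order, names and proof texts are those of «SkelFrmFromBChoiceDefs3», byte-identical except
(i) the carrier token `PlanarSkeletonFrmFrom ↦ PlanarSkeletonFrmQuasi` in binders, `namespace`/`end` lines and qualified names (module names `SkelFrmFrom… ↦ SkelFrmQuasi…`
in imports of already-ported rows); (ii) `Φ.step ↦ Φ.qstep` with the called Steps lemma replaced by its `…Q`/`_q` twin and the cost `Φ.M` threaded (none in this file unless
listed below); (iii) `Φ.cyl_connected ↦ Φ.cyl_reach` readers (none unless listed); (iv) graph-ball radii / window floors ×`Φ.M` (none unless listed).  Carrier-free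
residents stay imported/exported from the original «SkelFrmBChoiceDefs3» exactly as in the FrmFrom port.  Docstrings and citations are the original's.

-/

noncomputable section

open scoped Classical

namespace Summit.CriticalPhenomena.PercolationContinuityZ3.Theorems.Transplant

open MeasureTheory Literature.Probability.Percolation Literature.Probability.LatticeModels SimpleGraph KNCells
open Literature.Barriers.CriticalPhenomena (HasExponentialGrowth)

namespace PlanarSkeletonFrmQuasi

open SkelConc (Consts)
open Skelφ.StepI (DataN DataNS OutNS)

namespace NegB

open Neg

section Acc

variable (κ : Consts) {V : Type} [DecidableEq V] [Countable V] {G : SimpleGraph V} [G.LocallyFinite] (Φ : PlanarSkeletonFrmQuasi G)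

/-- **THE STEP-I‴ ACCURACY OF THE N2 CHOICE FUNCTION OF RECORD: THE CUBE** `δI3 := δkit³ / 16` (J11/(R-33): the (S0) kit consumes routes at the cube of the kit accuracy;
the `/16` keeps N1's slack for ≤ 16-fold unions). [this work] -/
def δI3 : ℝ := Neg.δkit κ Φ ^ 3 / 16

/-- `0 < δI3`. [folklore] -/
theorem δI3_pos : 0 < δI3 κ Φ := by
  unfold δI3; have := Neg.δkit_pos κ Φ; positivity

/-- `δI3 ≤ a³ / 16` whenever `δkit ≤ a`. [folklore] -/
theorem δI3_le_cube_div_of_le {a : ℝ} (ha : Neg.δkit κ Φ ≤ a) : δI3 κ Φ ≤ a ^ 3 / 16 := by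
  unfold δI3
  have h := pow_le_pow_left₀ (Neg.δkit_pos κ Φ).le ha 3
  linarith

/-- **`δI3 ≤ a³` whenever `δkit ≤ a`** — the consumers' pattern: Step-I‴ inputs `> 1 − δI3` serve every route clause at `1 − a³` for `a ∈ {κ.δr 0, κ.δ₂, κ.δ, …}` via
`Neg.δkit_le_δr / δkit_le_δ₂ / δkit_le_δ` and `inputs_mono`. [folklore] -/
theorem δI3_le_cube_of_le {a : ℝ} (ha : Neg.δkit κ Φ ≤ a) : δI3 κ Φ ≤ a ^ 3 := by
  have h := δI3_le_cube_div_of_le κ Φ ha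
  have h0 : 0 ≤ a ^ 3 := pow_nonneg ((Neg.δkit_pos κ Φ).le.trans ha) 3
  linarith

/-- `δI3 ≤ δI` (the cube is finer than N1's square since `δkit ≤ 1`): every square-threshold consumer still applies. [folklore] -/
theorem δI3_le_δI : δI3 κ Φ ≤ Neg.δI κ Φ := by
  rw [(Neg.δI_eq κ Φ).1]; unfold δI3
  have h0 := Neg.δkit_pos κ Φ
  have h1 := Neg.δkit_le_one κ Φ
  have h3 : Neg.δkit κ Φ ^ 3 ≤ Neg.δkit κ Φ ^ 2 := by nlinarith
  nlinarith

/-- `δI3 < 1`. [folklore] -/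
theorem δI3_lt_one : δI3 κ Φ < 1 := (δI3_le_δI κ Φ).trans_lt (Neg.δI_lt_one κ Φ)

-- GEN-Q (R-2, captain 2026-08-27): `PlanarSkeletonFrmFrom.NegB.δI3_le_one` is not in the used cone of the node top — not ported.

end Acc

section Values

variable (κ : Consts) {V : Type} [DecidableEq V] [Countable V] {G : SimpleGraph V} [G.LocallyFinite] (Φ : PlanarSkeletonFrmQuasi G) (t : V) (p : unitInterval)
  (Pv : PSlot) (gv fv : Neg.FSlot) (Sv : SSlot) (cv : CSlot) (bv : BSlot) (hC : Φ.CylSubcritical p)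

/-- **THE N2 CHOICES OF RECORD at `(κ, Φ, t, p)`, Step-I‴ accuracy at the cube**: `NegB.choiceAtQ` (p348247) with `δI := δI3` — `m₀`, `Sz`, `SMn`, `Γ = ΓQ`, `FD = FDQ`,
`LD = LDQ` unchanged. [cite: KozmaNitzan2024, §4 Theorem 6 (pp. 25–31)] -/
def choiceAtQ3 : ChoiceNQ κ Φ t p hC :=
  { choiceAtQ κ Φ t p Pv gv fv Sv cv bv hC with
    δI := δI3 κ Φ
    δI_pos := δI3_pos κ Φ
    δI_lt_one := δI3_lt_one κ Φ }

/-- The Step-I‴ accuracy of the choices of record is `δI3` (by `rfl`). [folklore] -/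
@[simp] theorem choiceAtQ3_δI : (choiceAtQ3 κ Φ t p Pv gv fv Sv cv bv hC).δI = δI3 κ Φ := rfl

/-- The least seed level is the landed one (by `rfl`). [folklore] -/
@[simp] theorem choiceAtQ3_m₀ : (choiceAtQ3 κ Φ t p Pv gv fv Sv cv bv hC).m₀ = (choiceAtQ κ Φ t p Pv gv fv Sv cv bv hC).m₀ := rfl

/-- The zone sizes are the landed ones (by `rfl`). [folklore] -/
@[simp] theorem choiceAtQ3_Sz : (choiceAtQ3 κ Φ t p Pv gv fv Sv cv bv hC).Sz = (choiceAtQ κ Φ t p Pv gv fv Sv cv bv hC).Sz := rfl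

/-- The admissible pairs are the landed ones (by `rfl`). [folklore] -/
@[simp] theorem choiceAtQ3_SMn : (choiceAtQ3 κ Φ t p Pv gv fv Sv cv bv hC).SMn = (choiceAtQ κ Φ t p Pv gv fv Sv cv bv hC).SMn := rfl

-- GEN-Q (R-2, captain 2026-08-27): `PlanarSkeletonFrmFrom.NegB.choiceAtQ3_Γ` is not in the used cone of the node top — not ported.

-- GEN-Q (R-2, captain 2026-08-27): `PlanarSkeletonFrmFrom.NegB.choiceAtQ3_FD` is not in the used cone of the node top — not ported.

-- GEN-Q (R-2, captain 2026-08-27): `PlanarSkeletonFrmFrom.NegB.choiceAtQ3_LD` is not in the used cone of the node top — not ported.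

-- GEN-Q (R-2, captain 2026-08-27): `PlanarSkeletonFrmFrom.NegB.choiceAtQ3_scheme` is not in the used cone of the node top — not ported.

end Values

end NegB

-- GEN-Q (R-2, captain 2026-08-27): `PlanarSkeletonFrmFrom.frmChoiceAllQ3` is not in the used cone of the node top — not ported.

-- GEN-Q (R-2, captain 2026-08-27): `PlanarSkeletonFrmFrom.frmChoiceAllQ3_eq` is not in the used cone of the node top — not ported.

-- GEN-Q (R-2, captain 2026-08-27): `PlanarSkeletonFrmFrom.frmChoiceAllQ3_scheme` is not in the used cone of the node top — not ported.

end PlanarSkeletonFrmQuasi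

end Summit.CriticalPhenomena.PercolationContinuityZ3.Theorems.Transplant

end
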